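import Summits.AtomisticToContinuum.Crystallization.Theorems.ChargedEnergyGap.Negative.BlocksBound
import Summits.AtomisticToContinuum.Crystallization.Theorems.OneCentreSteepnessLadderDominationEnergyLimitBlocks
import Literature.MathematicalPhysics.StatisticalMechanics.LennardJonesClusters

/-!
# Blocks of a periodic configuration are trial states for the truncated Lennard-Jones potential

Stub `exists_block_energy_le_truncLJ` (BLOCKS OF A PERIODIC CONFIGURATION ARE TRIAL STATES for the
range-2 truncated Lennard-Jones potential `V_χ = min 1 (max 0 (4 - 2r)) · V_LJ`) of the line
`sharp-m-potential-compactness` for the crux `PricedLinkCensus.TruncatedCensusGap`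
(item stmt-AtomisticToContinuum-14230).  The statement at the end is the registered signature
VERBATIM; it is the `V_χ` twin of the Lennard-Jones lemma
`ChargedEnergyGapNegative.Blocks.exists_block_energy_le` (`ChargedEnergyGap/Negative/BlocksBound`).

For a periodic configuration `Q = F + G` of `ℝ³` and `K ≥ 1`, the block
`blockConfig Q K : Fin (#F·K³) → ℝ³` lists the points `x + Σ kᵢ bᵢ` (`x ∈ F`, `0 ≤ kᵢ < K`, `b` a
`ℤ`-basis of `G`).  For every `ε > 0` and all large `K`,
`E_{V_χ}(block) ≤ #F K³ · (e_{V_χ}(Q) + ε)`.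

## Proof layout

The tree already runs the block bookkeeping of `BlocksEnergy`/`BlocksTails`/`BlocksBound` for a
GENERAL pair potential `V` with `V 0 = 0`, summable lattice sums `Σ_{q ∈ Q, q ≠ p} V(|p − q|)`
and an inverse-power minorant `V(r) ≥ −c·r⁻ⁿ` on `(0, ∞)` (`c ≥ 0`, `n > 3`):
`DominationEnergyLimit.exists_block_energy_le_of`
(`Theorems/OneCentreSteepnessLadderDominationEnergyLimitBlocks.lean`; the exact identity
`2·E_V(block_K) = K³ · 2#F · e_V(Q) − Σ_u tail_V(u)`, tails `≥ −c·(inverse-power tail)`, and the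
inverse-power tails sum to `o(K³)`).  This file checks the three hypotheses for `V_χ` with
`n = 6`, `c = 1/6`:

* `truncLJ_zero`: `V_χ 0 = 0` (Lean's `0⁻¹ = 0`);
* `summable_truncLJ_dist`: `‖V_χ‖ ≤ |V_LJ|` (the cut-off factor lies in `[0, 1]`), and the
  Lennard-Jones lattice sums of a periodic configuration of `ℝ³` are absolutely summable
  (`PeriodicConfiguration.summable_lennardJones_dist_three`);
* `neg_inv_pow_six_le_truncLJ`: `V_χ ≥ min 0 V_LJ ≥ −r⁻⁶/6` for `r > 0`.
-/

noncomputable section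

namespace Summit.AtomisticToContinuum.Crystallization.Theorems.PricedLinkCensusTruncatedCensusGap

open Literature.MathematicalPhysics.StatisticalMechanics Literature.Geometry.DiscreteGeometry
open Summit.AtomisticToContinuum.Crystallization.Theorems.ChargedEnergyGapNegative
open Summit.AtomisticToContinuum.Crystallization.Theorems.ChargedEnergyGapNegative.Blocks
open scoped BigOperators

/-! ### The truncated Lennard-Jones potential satisfies the three hypotheses -/

/-- `V_χ(0) = 0` (Lean's `0⁻¹ = 0`). [folklore] -/
theorem truncLJ_zero : (fun r : ℝ => min 1 (max 0 (4 - 2 * r)) * lennardJones r) 0 = 0 := by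
  simp [lennardJones_zero]

/-- The cut-off factor `χ(r) = min 1 (max 0 (4 − 2r))` lies in `[0, 1]`. [folklore] -/
theorem truncFactor_mem_Icc (r : ℝ) : min 1 (max 0 (4 - 2 * r)) ∈ Set.Icc (0 : ℝ) 1 :=
  ⟨le_min zero_le_one (le_max_left _ _), min_le_left _ _⟩

/-- `‖V_χ(r)‖ ≤ |V_LJ(r)|`, since `0 ≤ χ ≤ 1`. [folklore] -/
theorem norm_truncLJ_le_abs (r : ℝ) :
    ‖min 1 (max 0 (4 - 2 * r)) * lennardJones r‖ ≤ |lennardJones r| := by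
  obtain ⟨hc0, hc1⟩ := truncFactor_mem_Icc r
  rw [Real.norm_eq_abs, abs_mul, abs_of_nonneg hc0]
  exact mul_le_of_le_one_left (abs_nonneg _) hc1

/-- **The `V_χ` lattice sums of a periodic configuration of `ℝ³` are summable** (comparison
with the absolutely summable Lennard-Jones lattice sum, exponents `6, 12 > 3`). [folklore] -/
theorem summable_truncLJ_dist (Q : PeriodicConfiguration 3) (p : E3) :
    Summable fun q : {q : E3 // q ∈ Q.points ∧ q ≠ p} =>
      (fun r : ℝ => min 1 (max 0 (4 - 2 * r)) * lennardJones r) (dist p q.1) :=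
  (Q.summable_lennardJones_dist_three p).abs.of_norm_bounded fun _ => norm_truncLJ_le_abs _

/-- `V_χ(r) ≥ −r⁻⁶/6` for `r > 0`: `V_χ = χ·V_LJ` with `χ ∈ [0, 1]`, so `V_χ ≥ min 0 V_LJ`, and
`V_LJ(r) ≥ −r⁻⁶/6`. [folklore] -/
theorem neg_inv_pow_six_le_truncLJ (r : ℝ) (hr : 0 < r) :
    -(1 / 6 * r⁻¹ ^ 6) ≤ (fun r : ℝ => min 1 (max 0 (4 - 2 * r)) * lennardJones r) r := by
  obtain ⟨hc0, hc1⟩ := truncFactor_mem_Icc r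
  have h1 : -(1 / 6 * r⁻¹ ^ 6) ≤ lennardJones r := neg_le_lennardJones_of_le hr le_rfl
  have h0 : -(1 / 6 * r⁻¹ ^ 6) ≤ 0 := by
    have : 0 ≤ r⁻¹ ^ 6 := by positivity
    linarith
  show -(1 / 6 * r⁻¹ ^ 6) ≤ min 1 (max 0 (4 - 2 * r)) * lennardJones r
  rcases le_or_gt 0 (lennardJones r) with hLJ | hLJ
  · exact h0.trans (mul_nonneg hc0 hLJ)
  · calc -(1 / 6 * r⁻¹ ^ 6) ≤ lennardJones r := h1
      _ = 1 * lennardJones r := (one_mul _).symm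
      _ ≤ min 1 (max 0 (4 - 2 * r)) * lennardJones r := mul_le_mul_of_nonpos_right hc1 hLJ.le

/-- **Blocks of a periodic configuration are trial states for `V_χ`** (registered form): for every periodic configuration `Q` of `ℝ³` and every `ε > 0` there is `K₀ ≥ 1` such that for all `K ≥ K₀` the `K×K×K` block of `Q` has `V_χ`-energy at most `#block · (e_{V_χ}(Q) + ε)` — the general block bound `DominationEnergyLimit.exists_block_energy_le_of` with `V 0 = 0`, summable lattice sums and the minorant `−r⁻⁶/6`. [folklore] -/
theorem exists_block_energy_le_truncLJ : ∀ (Q : PeriodicConfiguration 3) (ε : ℝ), 0 < ε → ∃ K₀ : ℕ, 0 < K₀ ∧ ∀ K : ℕ, K₀ ≤ K → interactionEnergy (fun r => min 1 (max 0 (4 - 2 * r)) * lennardJones r) (Summit.AtomisticToContinuum.Crystallization.Theorems.ChargedEnergyGapNegative.Blocks.blockConfig Q K) ≤ (Fintype.card (Summit.AtomisticToContinuum.Crystallization.Theorems.ChargedEnergyGapNegative.Blocks.BIdx Q K) : ℝ) * (Q.energyPerParticle (fun r => min 1 (max 0 (4 - 2 * r)) * lennardJones r) + ε) := by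
  intro Q ε hε
  exact DominationEnergyLimit.exists_block_energy_le_of Q
    (V := fun r : ℝ => min 1 (max 0 (4 - 2 * r)) * lennardJones r) truncLJ_zero (n := 6)
    (by norm_num) (c := 1 / 6) (by norm_num) neg_inv_pow_six_le_truncLJ (summable_truncLJ_dist Q)
    hε

end Summit.AtomisticToContinuum.Crystallization.Theorems.PricedLinkCensusTruncatedCensusGap

end
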